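import Mathlib.Analysis.Analytic.OfScalars
import Mathlib.Analysis.Analytic.Uniqueness
import Mathlib.Analysis.Analytic.ChangeOrigin
import Mathlib.Analysis.Complex.TaylorSeries
import Mathlib.Analysis.Complex.CauchyIntegral
import Mathlib.Analysis.Calculus.IteratedDeriv.Lemmas
import Mathlib.Analysis.Calculus.Deriv.Polynomial
import Mathlib.Analysis.SpecificLimits.Normed
import Mathlib.RingTheory.PowerSeries.Derivative
import Literature.Barriers.Schanuel.EFunctionValuesAtAlgebraicPoints
import Literature.Analysis.TotalPositivity.PolyaFrequencyEntire
import HarnessLib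

/-!
# Barrier (Schanuel) `EFunctionValuesAtAlgebraicPoints`: analytic preliminaries on `eSeries` — proofs only

`Literature/Barriers/Schanuel/EFunctionValuesAtAlgebraicPointsSeries.lean` — first sibling file of
`EFunctionValuesAtAlgebraicPoints.lean` in the programme to discharge the named fact
`siegelShidlovskii_algIndep` (= the catalogue declaration `EFunctionValuesAtAlgebraicPoints`;
Siegel–Shidlovskii, Rivoal Thm. 5.10 / Baker Thm. 11.1). It supplies the dictionary between the
FUNCTIONS `eSeries a : ℂ → ℂ`, `z ↦ ∑ aₙ zⁿ/n!`, in which the named fact is stated, and FORMAL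
POWER SERIES, in which the Siegel–Shidlovskii argument (Baker, *Transcendental Number Theory*,
Ch. 11) is carried out:

* `ExpBound a` (`|aₙ| ≤ A Bⁿ`), implied by condition (ii) of `IsStrictEFunction`
  (`IsStrictEFunction.expBound`), stable under shift, sums, scalars and the binomial
  convolution `binomConv` (the coefficient sequence of a product of two `eSeries`);
* under `ExpBound a`: `eSeries a` is the sum of the formal multilinear series
  `ofScalars ℂ (aₙ/n!)` on all of `ℂ` (`hasFPowerSeriesOnBall_eSeries`), hence entire
  (`differentiable_eSeries`) with Taylor coefficients `iteratedDeriv k (eSeries a) 0 = a k`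
  (`iteratedDeriv_eSeries_zero`);
* the Taylor map `taylorPS f = ∑ f⁽ⁿ⁾(0)/n! Xⁿ ∈ ℂ⟦X⟧` is injective on entire functions
  (`taylorPS_inj`), multiplicative and additive, takes `deriv` to `PowerSeries.derivative`
  (`taylorPS_deriv`), polynomial functions to polynomials (`taylorPS_polynomial`, via
  `Literature.Analysis.TotalPositivity.iteratedDeriv_polynomial_eval_zero`) and `eSeries a`
  to `PowerSeries.mk (aₙ/n!)` (`taylorPS_eSeries`); consequently
  `deriv (eSeries a) = eSeries (n ↦ a (n+1))` and `eSeries a * eSeries b = eSeries (binomConv a b)`.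

All statements here are standard complex analysis ([folklore]); they are the "readily verified"
closure facts of Baker, Ch. 11 §1 (p. 104) in the form needed later. No new named facts.

## References

* [Rivoal2024] T. Rivoal, *Les E-fonctions et G-fonctions de Siegel*, X-UPS 2019 (2024), Déf. 5.2.
* A. Baker, *Transcendental Number Theory* (1975), Ch. 11 §1.
-/

noncomputable section

open Complex Polynomial FormalMultilinearSeries
open scoped Nat Topology

namespace Literature.Barriers.Schanuel

/-! ### 1. Exponential-type coefficient bounds -/

/-- `ExpBound a`: the coefficient sequence grows at most geometrically, `‖aₙ‖ ≤ A·Bⁿ` with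
`A, B ≥ 0` (condition (ii) of a strict `E`-function for the coefficient itself). [folklore] -/
def ExpBound (a : ℕ → ℂ) : Prop :=
  ∃ A B : ℝ, 0 ≤ A ∧ 0 ≤ B ∧ ∀ n, ‖a n‖ ≤ A * B ^ n

/-- The binomial convolution `(a ⋆ b)ₙ = ∑ₖ C(n,k) aₖ bₙ₋ₖ`: the coefficient sequence of the
product `eSeries a * eSeries b`. [folklore] -/
def binomConv (a b : ℕ → ℂ) (n : ℕ) : ℂ :=
  ∑ k ∈ Finset.range (n + 1), (n.choose k : ℂ) * a k * b (n - k)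

/-- Condition (ii) of a strict `E`-function bounds the coefficients themselves:
`aₙ` is a root of its own minimal polynomial. [cite: Rivoal2024, Définition 5.2] -/
theorem IsStrictEFunction.expBound {a : ℕ → ℂ} (h : IsStrictEFunction a) : ExpBound a := by
  obtain ⟨halg, -, ⟨C, hC, hb⟩, -⟩ := h
  refine ⟨C, C, hC.le, hC.le, fun n => ?_⟩
  have hmem : a n ∈ (minpoly ℚ (a n)).rootSet ℂ := by
    rw [Polynomial.mem_rootSet]
    exact ⟨minpoly.ne_zero (isAlgebraic_iff_isIntegral.mp (halg n)), minpoly.aeval ℚ (a n)⟩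
  simpa [pow_succ'] using hb n (a n) hmem

namespace ExpBound

variable {a b : ℕ → ℂ}

/-- Shifting preserves geometric growth. [folklore] -/
theorem shift (h : ExpBound a) : ExpBound fun n => a (n + 1) := by
  obtain ⟨A, B, hA, hB, hab⟩ := h
  refine ⟨A * B, B, mul_nonneg hA hB, hB, fun n => ?_⟩
  simpa [pow_succ', mul_assoc, mul_comm, mul_left_comm] using hab (n + 1)

/-- Iterated shifts preserve geometric growth. [folklore] -/
theorem shift_iterate (h : ExpBound a) (k : ℕ) : ExpBound fun n => a (n + k) := by
  induction k with
  | zero => simpa using h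
  | succ k ih =>
    have h' : ExpBound fun n => a (n + 1 + k) := ih.shift
    have heq : (fun n => a (n + (k + 1))) = fun n => a (n + 1 + k) := by
      funext n
      rw [Nat.add_right_comm, Nat.add_assoc]
    rw [heq]
    exact h'

/-- Sums preserve geometric growth. [folklore] -/
theorem add (ha : ExpBound a) (hb : ExpBound b) : ExpBound fun n => a n + b n := by
  obtain ⟨A, B, hA, hB, hab⟩ := ha
  obtain ⟨A', B', hA', hB', hab'⟩ := hb
  refine ⟨A + A', max B B', add_nonneg hA hA', le_max_of_le_left hB, fun n => ?_⟩
  calc ‖a n + b n‖ ≤ ‖a n‖ + ‖b n‖ := norm_add_le _ _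
    _ ≤ A * B ^ n + A' * B' ^ n := add_le_add (hab n) (hab' n)
    _ ≤ A * (max B B') ^ n + A' * (max B B') ^ n := by
        gcongr
        · exact le_max_left _ _
        · exact le_max_right _ _
    _ = (A + A') * (max B B') ^ n := by ring

/-- Scalar multiples preserve geometric growth. [folklore] -/
theorem const_mul (ha : ExpBound a) (c : ℂ) : ExpBound fun n => c * a n := by
  obtain ⟨A, B, hA, hB, hab⟩ := ha
  refine ⟨‖c‖ * A, B, mul_nonneg (norm_nonneg _) hA, hB, fun n => ?_⟩
  rw [norm_mul, mul_assoc]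
  exact mul_le_mul_of_nonneg_left (hab n) (norm_nonneg _)

/-- The zero sequence has geometric growth. [folklore] -/
theorem zero : ExpBound fun _ => (0 : ℂ) :=
  ⟨0, 0, le_rfl, le_rfl, fun n => by simp⟩

/-- An eventually-zero sequence has geometric growth. [folklore] -/
theorem of_eventually_zero {N : ℕ} (h : ∀ n, N ≤ n → a n = 0) : ExpBound a := by
  refine ⟨∑ k ∈ Finset.range N, ‖a k‖, 1, Finset.sum_nonneg fun _ _ => norm_nonneg _,
    zero_le_one, fun n => ?_⟩
  rw [one_pow, mul_one]
  by_cases hn : N ≤ n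
  · rw [h n hn, norm_zero]
    exact Finset.sum_nonneg fun _ _ => norm_nonneg _
  · exact Finset.single_le_sum (f := fun k => ‖a k‖) (fun _ _ => norm_nonneg _)
      (Finset.mem_range.mpr (lt_of_not_ge hn))

/-- Finite sums preserve geometric growth. [folklore] -/
theorem sum {ι : Type*} (s : Finset ι) (f : ι → ℕ → ℂ) (h : ∀ i ∈ s, ExpBound (f i)) :
    ExpBound fun n => ∑ i ∈ s, f i n := by
  classical
  induction s using Finset.induction_on with
  | empty => simpa using zero
  | insert i s hi ih =>
    have := (h i (Finset.mem_insert_self _ _)).add (ih fun j hj => h j (Finset.mem_insert_of_mem hj))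
    simpa [Finset.sum_insert hi] using this

/-- The binomial convolution of two geometrically bounded sequences is geometrically bounded:
`‖(a⋆b)ₙ‖ ≤ ∑ C(n,k) A Bᵏ A' B'ⁿ⁻ᵏ = A A' (B + B')ⁿ`. [folklore] -/
theorem conv (ha : ExpBound a) (hb : ExpBound b) : ExpBound (binomConv a b) := by
  obtain ⟨A, B, hA, hB, hab⟩ := ha
  obtain ⟨A', B', hA', hB', hab'⟩ := hb
  refine ⟨A * A', B + B', mul_nonneg hA hA', add_nonneg hB hB', fun n => ?_⟩
  calc ‖binomConv a b n‖
      ≤ ∑ k ∈ Finset.range (n + 1), ‖(n.choose k : ℂ) * a k * b (n - k)‖ := norm_sum_le _ _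
    _ ≤ ∑ k ∈ Finset.range (n + 1), (n.choose k : ℝ) * (A * B ^ k) * (A' * B' ^ (n - k)) := by
        refine Finset.sum_le_sum fun k _ => ?_
        rw [norm_mul, norm_mul, Complex.norm_natCast]
        gcongr
        · exact hab k
        · exact hab' (n - k)
    _ = A * A' * ∑ k ∈ Finset.range (n + 1), B ^ k * B' ^ (n - k) * (n.choose k : ℝ) := by
        rw [Finset.mul_sum]
        refine Finset.sum_congr rfl fun k _ => ?_
        ring
    _ = A * A' * (B + B') ^ n := by rw [add_pow]

end ExpBound

/-! ### 2. `eSeries a` is an entire function with Taylor coefficients `aₙ` -/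

section Entire

variable {a : ℕ → ℂ}

/-- `eSeries a` is the sum of the scalar formal multilinear series with coefficients `aₙ/n!`.
[folklore] -/
theorem eSeries_eq_ofScalarsSum (a : ℕ → ℂ) :
    eSeries a = ofScalarsSum (E := ℂ) (fun n => a n / (n ! : ℂ)) := by
  funext z
  rw [ofScalars_sum_eq]
  unfold eSeries
  refine tsum_congr fun n => ?_
  rw [smul_eq_mul]
  ring

/-- Under `ExpBound a` the series `∑ aₙ zⁿ/n!` has infinite radius of convergence. [folklore] -/
theorem radius_ofScalars_eq_top (h : ExpBound a) :
    (ofScalars ℂ fun n => a n / (n ! : ℂ)).radius = ⊤ := by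
  obtain ⟨A, B, hA, hB, hab⟩ := h
  refine radius_eq_top_of_summable_norm _ fun r => ?_
  have hs : Summable fun n : ℕ => A * ((B * r) ^ n / n !) :=
    (Real.summable_pow_div_factorial (B * r)).mul_left A
  refine Summable.of_nonneg_of_le (fun n => by positivity) (fun n => ?_) hs
  rw [ofScalars_norm, norm_div, Complex.norm_natCast]
  calc ‖a n‖ / (n ! : ℝ) * (r : ℝ) ^ n ≤ A * B ^ n / (n ! : ℝ) * (r : ℝ) ^ n := by
        gcongr
        exact hab n
    _ = A * ((B * r) ^ n / n !) := by rw [mul_pow]; ring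

/-- `eSeries a` is represented by its power series on all of `ℂ`. [folklore] -/
theorem hasFPowerSeriesOnBall_eSeries (h : ExpBound a) :
    HasFPowerSeriesOnBall (eSeries a) (ofScalars ℂ fun n => a n / (n ! : ℂ)) 0 ⊤ := by
  have hrad := radius_ofScalars_eq_top h
  have := (ofScalars ℂ fun n => a n / (n ! : ℂ)).hasFPowerSeriesOnBall (by simp [hrad])
  rw [hrad] at this
  rwa [eSeries_eq_ofScalarsSum]

/-- `eSeries a` is analytic at every point. [folklore] -/
theorem analyticAt_eSeries (h : ExpBound a) (z : ℂ) : AnalyticAt ℂ (eSeries a) z :=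
  (hasFPowerSeriesOnBall_eSeries h).analyticAt_of_mem (by simp)

/-- `eSeries a` is an entire function. [folklore] -/
theorem differentiable_eSeries (h : ExpBound a) : Differentiable ℂ (eSeries a) :=
  fun z => (analyticAt_eSeries h z).differentiableAt

/-- The convergent sum: `HasSum (n ↦ aₙ zⁿ/n!) (eSeries a z)`. [folklore] -/
theorem hasSum_eSeries (h : ExpBound a) (z : ℂ) :
    HasSum (fun n => a n * z ^ n / (n ! : ℂ)) (eSeries a z) := by
  have := (hasFPowerSeriesOnBall_eSeries h).hasSum (y := z) (by simp)
  simp only [zero_add, ofScalars_apply_eq, smul_eq_mul] at this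
  have heq : (fun n => a n * z ^ n / (n ! : ℂ)) = fun n => a n / (n ! : ℂ) * z ^ n := by
    funext n
    ring
  rw [heq]
  exact this

/-- **Taylor coefficients**: `(eSeries a)⁽ᵏ⁾(0) = aₖ`. [folklore] -/
theorem iteratedDeriv_eSeries_zero (h : ExpBound a) (k : ℕ) :
    iteratedDeriv k (eSeries a) 0 = a k := by
  have h₁ : HasFPowerSeriesAt (eSeries a) (ofScalars ℂ fun n => a n / (n ! : ℂ)) 0 :=
    ⟨⊤, hasFPowerSeriesOnBall_eSeries h⟩
  have h₂ := (analyticAt_eSeries h 0).hasFPowerSeriesAt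
  have heq := congr_fun (ofScalars_series_injective ℂ ℂ (h₂.eq_formalMultilinearSeries h₁)) k
  have hk : (k ! : ℂ) ≠ 0 := by exact_mod_cast k.factorial_ne_zero
  simpa [div_left_inj' hk] using heq

end Entire

/-! ### 3. The Taylor map to formal power series -/

section Taylor

/-- The Taylor series at `0` of a function `f : ℂ → ℂ`, as a formal power series
`∑ f⁽ⁿ⁾(0)/n! · Xⁿ ∈ ℂ⟦X⟧`. [folklore] -/
def taylorPS (f : ℂ → ℂ) : PowerSeries ℂ :=
  PowerSeries.mk fun n => iteratedDeriv n f 0 / (n ! : ℂ)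

/-- Coefficients of the Taylor series. [folklore] -/
@[simp] theorem coeff_taylorPS (f : ℂ → ℂ) (n : ℕ) :
    PowerSeries.coeff n (taylorPS f) = iteratedDeriv n f 0 / (n ! : ℂ) := by
  simp [taylorPS]

variable {f g : ℂ → ℂ}

/-- An entire function is determined by its Taylor series at `0`. [folklore] -/
theorem taylorPS_inj (hf : Differentiable ℂ f) (hg : Differentiable ℂ g)
    (h : taylorPS f = taylorPS g) : f = g := by
  funext z
  rw [← Complex.taylorSeries_eq_of_entire' 0 z hf, ← Complex.taylorSeries_eq_of_entire' 0 z hg]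
  refine tsum_congr fun n => ?_
  have := congr_arg (PowerSeries.coeff n) h
  simp only [coeff_taylorPS, div_eq_inv_mul] at this
  rw [this]

/-- The Taylor map is additive on entire functions. [folklore] -/
theorem taylorPS_add (hf : Differentiable ℂ f) (hg : Differentiable ℂ g) :
    taylorPS (f + g) = taylorPS f + taylorPS g := by
  ext n
  simp only [coeff_taylorPS, map_add]
  rw [iteratedDeriv_add (hf.contDiff.contDiffAt) (hg.contDiff.contDiffAt), add_div]

/-- The Taylor map commutes with constant multiples. [folklore] -/
theorem taylorPS_const_mul (hf : Differentiable ℂ f) (c : ℂ) :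
    taylorPS (fun z => c * f z) = PowerSeries.C c * taylorPS f := by
  ext n
  simp only [coeff_taylorPS, PowerSeries.coeff_C_mul]
  rw [iteratedDeriv_const_mul c (hf.contDiff.contDiffAt), mul_div_assoc]

/-- The Taylor map is multiplicative on entire functions (Leibniz rule). [folklore] -/
theorem taylorPS_mul (hf : Differentiable ℂ f) (hg : Differentiable ℂ g) :
    taylorPS (f * g) = taylorPS f * taylorPS g := by
  ext n
  rw [coeff_taylorPS, PowerSeries.coeff_mul,
    iteratedDeriv_mul (hf.contDiff.contDiffAt) (hg.contDiff.contDiffAt),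
    Finset.Nat.sum_antidiagonal_eq_sum_range_succ_mk, Finset.sum_div]
  refine Finset.sum_congr rfl fun i hi => ?_
  have hin : i ≤ n := Nat.lt_succ_iff.mp (Finset.mem_range.mp hi)
  simp only [coeff_taylorPS]
  rw [Nat.cast_choose ℂ hin]
  have h1 : (i ! : ℂ) ≠ 0 := by exact_mod_cast i.factorial_ne_zero
  have h2 : ((n - i)! : ℂ) ≠ 0 := by exact_mod_cast (n - i).factorial_ne_zero
  have h3 : (n ! : ℂ) ≠ 0 := by exact_mod_cast n.factorial_ne_zero
  field_simp

/-- The Taylor map takes `deriv` to the formal derivative `d⁄dX`. [folklore] -/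
theorem taylorPS_deriv (f : ℂ → ℂ) :
    taylorPS (deriv f) = PowerSeries.derivative ℂ (taylorPS f) := by
  ext n
  rw [coeff_taylorPS, PowerSeries.coeff_derivative, coeff_taylorPS, ← iteratedDeriv_succ',
    Nat.factorial_succ]
  have h1 : (n ! : ℂ) ≠ 0 := by exact_mod_cast n.factorial_ne_zero
  have h2 : ((n + 1 : ℕ) : ℂ) ≠ 0 := by exact_mod_cast Nat.succ_ne_zero n
  push_cast
  field_simp

/-- The Taylor series of a polynomial function is the polynomial. [folklore] -/
theorem taylorPS_polynomial (p : ℂ[X]) : taylorPS (fun z => p.eval z) = (p : PowerSeries ℂ) := by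
  ext n
  rw [coeff_taylorPS, Literature.Analysis.TotalPositivity.iteratedDeriv_polynomial_eval_zero,
    Polynomial.coeff_coe]
  have h1 : (n ! : ℂ) ≠ 0 := by exact_mod_cast n.factorial_ne_zero
  field_simp

variable {a b : ℕ → ℂ}

/-- The Taylor series of `eSeries a` is `∑ (aₙ/n!) Xⁿ`. [folklore] -/
theorem taylorPS_eSeries (h : ExpBound a) :
    taylorPS (eSeries a) = PowerSeries.mk fun n => a n / (n ! : ℂ) := by
  ext n
  rw [coeff_taylorPS, iteratedDeriv_eSeries_zero h, PowerSeries.coeff_mk]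

/-- **Derivative of an `eSeries`**: `(∑ aₙ zⁿ/n!)′ = ∑ aₙ₊₁ zⁿ/n!`. [folklore] -/
theorem deriv_eSeries (h : ExpBound a) : deriv (eSeries a) = eSeries fun n => a (n + 1) := by
  apply taylorPS_inj (differentiable_eSeries h).deriv (differentiable_eSeries h.shift)
  rw [taylorPS_deriv, taylorPS_eSeries h, taylorPS_eSeries h.shift]
  ext n
  rw [PowerSeries.coeff_derivative, PowerSeries.coeff_mk, PowerSeries.coeff_mk, Nat.factorial_succ]
  have h1 : (n ! : ℂ) ≠ 0 := by exact_mod_cast n.factorial_ne_zero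
  have h2 : ((n + 1 : ℕ) : ℂ) ≠ 0 := by exact_mod_cast Nat.succ_ne_zero n
  push_cast
  field_simp

/-- Iterated derivatives of an `eSeries` are the shifted `eSeries`. [folklore] -/
theorem iteratedDeriv_eSeries (h : ExpBound a) (k : ℕ) :
    iteratedDeriv k (eSeries a) = eSeries fun n => a (n + k) := by
  induction k with
  | zero => simp
  | succ k ih =>
    rw [iteratedDeriv_succ, ih, deriv_eSeries (h.shift_iterate k)]
    simp only [Nat.add_succ, Nat.succ_add]

/-- **Product of two `eSeries`** is the `eSeries` of the binomial convolution. [folklore] -/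
theorem eSeries_mul (ha : ExpBound a) (hb : ExpBound b) :
    eSeries a * eSeries b = eSeries (binomConv a b) := by
  apply taylorPS_inj ((differentiable_eSeries ha).mul (differentiable_eSeries hb))
    (differentiable_eSeries (ha.conv hb))
  rw [taylorPS_mul (differentiable_eSeries ha) (differentiable_eSeries hb), taylorPS_eSeries ha,
    taylorPS_eSeries hb, taylorPS_eSeries (ha.conv hb)]
  ext n
  rw [PowerSeries.coeff_mul, Finset.Nat.sum_antidiagonal_eq_sum_range_succ_mk]
  simp only [PowerSeries.coeff_mk, binomConv, Finset.sum_div]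
  refine Finset.sum_congr rfl fun i hi => ?_
  have hin : i ≤ n := Nat.lt_succ_iff.mp (Finset.mem_range.mp hi)
  rw [Nat.cast_choose ℂ hin]
  have h1 : (i ! : ℂ) ≠ 0 := by exact_mod_cast i.factorial_ne_zero
  have h2 : ((n - i)! : ℂ) ≠ 0 := by exact_mod_cast (n - i).factorial_ne_zero
  have h3 : (n ! : ℂ) ≠ 0 := by exact_mod_cast n.factorial_ne_zero
  field_simp

/-- Sum of two `eSeries`. [folklore] -/
theorem eSeries_add (ha : ExpBound a) (hb : ExpBound b) :
    eSeries (fun n => a n + b n) = eSeries a + eSeries b := by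
  funext z
  have := (hasSum_eSeries ha z).add (hasSum_eSeries hb z)
  rw [Pi.add_apply, ← this.tsum_eq]
  unfold eSeries
  exact tsum_congr fun n => by ring

/-- Constant multiple of an `eSeries` (no growth hypothesis needed). [folklore] -/
theorem eSeries_const_mul (c : ℂ) (a : ℕ → ℂ) :
    eSeries (fun n => c * a n) = fun z => c * eSeries a z := by
  funext z
  unfold eSeries
  rw [← tsum_mul_left]
  refine tsum_congr fun n => ?_
  ring

/-- A polynomial function is the `eSeries` of `n! · pₙ` (a finitely supported sequence).
[folklore] -/
theorem expBound_polynomial (p : ℂ[X]) : ExpBound fun n => (n ! : ℂ) * p.coeff n :=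
  ExpBound.of_eventually_zero (N := p.natDegree + 1) fun n hn => by
    rw [Polynomial.coeff_eq_zero_of_natDegree_lt (Nat.lt_of_succ_le hn), mul_zero]

/-- A polynomial function as an `eSeries`. [folklore] -/
theorem eSeries_polynomial (p : ℂ[X]) :
    eSeries (fun n => (n ! : ℂ) * p.coeff n) = fun z => p.eval z := by
  apply taylorPS_inj (differentiable_eSeries (expBound_polynomial p)) p.differentiable
  rw [taylorPS_eSeries (expBound_polynomial p), taylorPS_polynomial]
  ext n
  rw [PowerSeries.coeff_mk, Polynomial.coeff_coe]
  have h1 : (n ! : ℂ) ≠ 0 := by exact_mod_cast n.factorial_ne_zero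
  field_simp

end Taylor

end Literature.Barriers.Schanuel

end
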